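import Summits.QuantumFields.QCD.Theses.GapBuysCauchyRate

/-!
# Route `GapBuysCauchyRate` — Assembly (item stmt-QuantumFields-11528)

The assembly item of route `route-QuantumFields-GapBuysCauchyRate` (sub-problem `QCD` of the summit
`QuantumFields`) is the four-hypothesis deciding chain

  `LadderCauchyRate → CauchySummation → ConvergentOSClosure → RotationRestoration → QCD`,

which is verbatim the type of the route's gate-checked deciding theorem
`Summit.QuantumFields.QCD.Theses.GapBuysCauchyRate.closes` (pure logic, standard axioms): for
`N_f ∈ {2, 3}` the rate crux `LadderCauchyRate` gives the regularisation `reg`, the calibrated family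
`𝒞`, one summable envelope `r` and, for every positive mass tuple `m`, the physical-branch / lattice-gap /
calibration / κ₃ clauses and the increment bounds `‖S_(k+1) − S_k‖ ≤ C·r_k`; `CauchySummation` turns each
increment bound into convergence along the full sequence; `ConvergentOSClosure` packages the convergent
calibrated family into a labelled Schwinger family `S` with E0, E0', translations, E2–E4, the
convergence-to-`S` clause and both gaps at one `Δ > 0`; `RotationRestoration` applied to `𝒞.scheme m`
gives proper-rotation invariance of `S`; the packaging clause yields `T : OSData` with `T.schwinger = S`
and the species clauses — the matrix of `QCDOf N_f` with `z := 𝒞.z m`, `shift := 𝒞.shift m`; finally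
`QCD = QCDOf 2 ∧ QCDOf 3`.

* `GapBuysCauchyRate.assembly_proof` — the route decl `Assembly`, literally; proof `exact closes` after
  unfolding. (Bookkeeping: this module imports the route module, so the gate records the closure as the
  docstring link `proved by …` rather than an in-file `Assembly_holds`, cf. docs/reference/gate.md §4.2.)

References: A. Jaffe, E. Witten, *Quantum Yang–Mills theory* (Clay problem description, 2000);
K. Osterwalder, R. Schrader, *Axioms for Euclidean Green's functions II*, Comm. Math. Phys. 42 (1975).
-/

namespace Summit.QuantumFields.QCD.Theorems

/-- **Assembly of route GapBuysCauchyRate** (item stmt-QuantumFields-11528):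
`LadderCauchyRate → CauchySummation → ConvergentOSClosure → RotationRestoration → QCD`.
This is literally the statement of the route's deciding theorem
`Summit.QuantumFields.QCD.Theses.GapBuysCauchyRate.closes` (the Cauchy-rate crux fed through
summation of increments, OS closure of the convergent calibrated family and the shared rotation module
gives `QCDOf 2 ∧ QCDOf 3 = QCD`), so the proof is `exact closes`. [folklore] -/
theorem GapBuysCauchyRate.assembly_proof :
    Summit.QuantumFields.QCD.Theses.GapBuysCauchyRate.Assembly := by
  unfold Summit.QuantumFields.QCD.Theses.GapBuysCauchyRate.Assembly
  exact Summit.QuantumFields.QCD.Theses.GapBuysCauchyRate.closes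

end Summit.QuantumFields.QCD.Theorems
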